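/-
Copyright (c) 2026 the pub-hodgecm-mathlib formalisation cell (harness21).  Prover seat hodgecm-mathlib-K2E3-p25 (g4), Track B «K2-LIT», E3 hand on loan to L1
(hLiu418 = `stmt-HodgeConjecture-24832`) by the chair's VALVE WORD W4; LEAD F0P6-plan (g14) BATCH #105 (3) VALVE DEAL (V-b); line lead (K1a-GK) K2E5-p16 (g8);
desk K2E3-p03 (g9) (`hdead` BY-VALUE LETTER TABLE 2026-09-04T22:46:16Z, row (3)).  THEOREMS ONLY (`--supports stmt-HodgeConjecture-24832 --as helper`):
no definition, no instance, no notation, no named-fact hypothesis, no `sorry`.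
-/
import Summits.HodgeConjecture.HodgeConjecture.Theorems.K2LiuRankOneIndexValue                 -- ★ (n1) `imPart_mem`, `imPart_ne_zero`, `imPart_mul_root_eq_self` (the `n = 1` twin `hval_fin_one`)
import Literature.NumberTheory.GelbartRogawski1991.LocalKudlaSplittingInjectiveTransported    -- ★ `gramR_eq_diagonal` (`T = gramR` is the diagonal `dV·dW`)
import HarnessLib

/-!
# Crux `HLiu418`, #42S organ S5, letter (V-b): THE VALUE OF A RANK-ONE SKEW INDEX AT `n ≃ 2` — the `val ∕ hval` binder of ★ p862379 `hdead_of_deadFactors`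

Cell `hodgecm-mathlib`, crux item hLiu418 = `stmt-HodgeConjecture-24832`; squad K2, prover K2E3-p25 (g4); count-neutral helper.
Namespace `Summit.HodgeConjecture.HodgeConjecture.Cruxes.HLiu418.K2LiuRankOneIndexValueTwo`.

THE BINDER (★ p862379 `K2LiuIncoherentRankOneDeadPlaces.hdead_of_deadFactors`, row (3) of K2E3-p03 (g9)'s table): `val : Matrix (Fin n) (Fin n) L → L⁺` with
`hval : ∀ X ∈ Skew_T(L), X ≠ 0 → det X = 0 → val X ≠ 0`, `T = T_L := gramR ⊗ L` the (diagonal, ★ `gramR_eq_diagonal`) Gram matrix of `V ⊗ W`, the index `n` GENERIC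
through `e : Fin 2 × Fin 1 ≃ Fin n` (the #42S datum).  Write `a := e (0,0)`, `b := e (1,0)` (the CORNER of ★ p862643 (K1a-1): `S♭ = σ♭ E_bb`, «`ψ_{S♭}` pairs with
`b₁₁` only»), `T_aa, T_bb ∈ L⁺` the diagonal entries, `α` a purely imaginary unit (`c α = −α`, `α ≠ 0`; at the tie ★ `cmQuadraticGenerator_spec`'s root) and
`ip x := (x − c x)(2α)⁻¹ ∈ L⁺` (★ (n1) `imPart_mem`).

THE MATHEMATICS.  For `X ∈ Skew_T` (`T X + (cX)ᵀ T = 0`) the matrix `β := α·T·X` is `c`-HERMITIAN; its diagonal is `β_kk = α T_kk X_kk = θ T_kk · ip(X_kk)` (`θ = α²`,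
`X_kk` purely imaginary) and its off-diagonal satisfies `T_bb X_ba = −T_aa c(X_ab)`.  If `det X = 0` and both diagonal entries vanish then `N(X_ab) = 0`, so
`X = 0`: a non-zero rank-one index has a non-zero diagonal entry (§1 `diag_ne_zero_or`).  A rank-one hermitian `β` is `β_kk · c(u) ⊗ u` (★ `K2LiuRankOneLineGram`), so
the NORM CLASS of the index is `β_kk · N(L^×)` for either `k` with `β_kk ≠ 0`; read at the corner line (Gram `T_bb`, the `n = 1` convention of ★ `hval_fin_one`) the
value is `β_kk ∕ (θ T_bb)`.  Hence the theorem-only choice (a TERM, no definition; SIG 2026-09-04T22:54Z → K2E5-p16 (g8)):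
  `val₂ X := if ip (X b b) = 0 then (T_aa · T_bb⁻¹) · ip (X a a) else ip (X b b)`
— corner entry first, the other diagonal entry RESCALED by `T_aa ∕ T_bb` so that `val₂ X · θ · T_bb = β_kk` in both branches.
* §1 skew bookkeeping on the diagonal datum: `gramRL_apply` (`T_L = diag`), `skew_entry` (`T_ii X_ij + c(X_ji) T_jj = 0`), `skew_diag_add_conj`, `det_eq_two_by_two`
  (`det X = X_aa X_bb − X_ab X_ba` along `Fin 2 ≃ Fin n`), `eq_zero_of_entries`, **`diag_ne_zero_or`** (`X ≠ 0 → det X = 0 → X_aa ≠ 0 ∨ X_bb ≠ 0`).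
* §2 **`hval₂_of_branches`** — HYPOTHESIS-FIRST: any `val` agreeing with the recipe on the two branches satisfies ★ p862379's `hval` bytes; **`hval₂`** — the same for
  the explicit `if`-term (`open scoped Classical` decidability, as the tie will paste it); `val₂_mul_sq_mul` (`val₂ X · α² · T_bb = α · T_kk · X_kk` for a `k` with
  `X_kk ≠ 0`).
[MoeglinWaldspurger1995, I.2.6] [Shimura1997, §18.1, §18.4] [KudlaRallis1994, §2–§3] [Kudla1997, §2] [Scharlau1985HermitianForms, Ch. 10 §1].

HONEST LABEL.  Count-neutral helper: `HC_CM` is proved only modulo the 7 printed citations (2 remaining named inputs: hLiu418 = `stmt-HodgeConjecture-24832`,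
h413 = `stmt-HodgeConjecture-24833`) until rung 0 closes; (V-b) is one by-value letter of the #42S `hdead` slot and closes no socket by itself.
-/

set_option autoImplicit false
set_option linter.dupNamespace false -- the mandated namespace repeats `HodgeConjecture.HodgeConjecture`

noncomputable section

open scoped Matrix
open NumberField IsDedekindDomain
open Literature.NumberTheory.Automorphic
open Literature.NumberTheory.GelbartRogawski1991 Literature.NumberTheory.GelbartRogawski1991.GRConstruction
open Summit.HodgeConjecture.HodgeConjecture.Cruxes.HLiu418.K2LiuSiegelUnipotentFourierDefs
open Summit.HodgeConjecture.HodgeConjecture.Cruxes.HLiu418.K2LiuRankOneIndexValue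

namespace Summit.HodgeConjecture.HodgeConjecture.Cruxes.HLiu418.K2LiuRankOneIndexValueTwo

variable (L : Type) [Field L] [NumberField L] [IsCMField L]
variable {n : ℕ} (e : Fin 2 × Fin 1 ≃ Fin n)
  (dV : Fin 2 → L) (hdV : ∀ i, IsCMField.complexConj L (dV i) = dV i) (hdV0 : ∀ i, dV i ≠ 0)
  (dW : Fin 1 → L) (hdW : ∀ i, IsCMField.complexConj L (dW i) = dW i) (hdW0 : ∀ i, dW i ≠ 0)

/-! ## §1 Skew bookkeeping on the diagonal datum `T = gramR = diag(dV·dW)` -/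

/-- **`T_L = gramR ⊗ L` IS DIAGONAL**: `T_L i j = if i = j then dV (e⁻¹ i).1 · dW (e⁻¹ i).2 else 0` (★ `gramR_eq_diagonal`).
[cite: GelbartRogawski1991, §3.1 Prop. 3.1.1 p. 455] -/
theorem gramRL_apply (i j : Fin n) :
    ((gramR L e dV hdV dW hdW).map (algebraMap (Fp L) L)) i j = if i = j then dV (e.symm i).1 * dW (e.symm i).2 else 0 := by
  rw [gramR_eq_diagonal, Matrix.map_apply, Matrix.diagonal_apply]
  split_ifs with h
  · rfl
  · exact map_zero _

/-- the diagonal entries of `T_L`. [cite: GelbartRogawski1991, §3.1 Prop. 3.1.1 p. 455] -/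
theorem gramRL_apply_same (i : Fin n) :
    ((gramR L e dV hdV dW hdW).map (algebraMap (Fp L) L)) i i = dV (e.symm i).1 * dW (e.symm i).2 := by
  rw [gramRL_apply, if_pos rfl]

include hdV0 hdW0 in
/-- the diagonal entries of `T_L` are non-zero. [cite: GelbartRogawski1991, §3.1 Prop. 3.1.1 p. 455] -/
theorem gramRL_apply_same_ne_zero (i : Fin n) :
    ((gramR L e dV hdV dW hdW).map (algebraMap (Fp L) L)) i i ≠ 0 := by
  rw [gramRL_apply_same]
  exact mul_ne_zero (hdV0 _) (hdW0 _)

/-- the diagonal entries of `T_L` are real (`c`-fixed). [cite: GelbartRogawski1991, §3.1 Prop. 3.1.1 p. 455] -/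
theorem complexConj_gramRL_apply_same (i : Fin n) :
    IsCMField.complexConj L (((gramR L e dV hdV dW hdW).map (algebraMap (Fp L) L)) i i) = ((gramR L e dV hdV dW hdW).map (algebraMap (Fp L) L)) i i := by
  rw [gramRL_apply_same, map_mul, hdV, hdW]

/-- the entry of `gramR` (over `L⁺`) at `(i,i)`, coerced to `L`, is the entry of `T_L`. [folklore] -/
theorem algebraMap_gramR_apply_same (i : Fin n) :
    algebraMap (Fp L) L ((gramR L e dV hdV dW hdW) i i) = ((gramR L e dV hdV dW hdW).map (algebraMap (Fp L) L)) i i := by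
  rw [Matrix.map_apply]

/-- the same with the subfield coercion `L⁺ → L`. [folklore] -/
theorem coe_gramR_apply_same (i : Fin n) :
    (((gramR L e dV hdV dW hdW) i i : Fp L) : L) = ((gramR L e dV hdV dW hdW).map (algebraMap (Fp L) L)) i i := by
  rw [Matrix.map_apply]
  rfl

include hdV0 hdW0 in
/-- the diagonal entries of `gramR` (over `L⁺`) are non-zero. [folklore] -/
theorem gramR_apply_same_ne_zero (i : Fin n) : (gramR L e dV hdV dW hdW) i i ≠ 0 := by
  intro h
  apply gramRL_apply_same_ne_zero L e dV hdV hdV0 dW hdW hdW0 i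
  rw [← algebraMap_gramR_apply_same, h, map_zero]

/-- **THE SKEW RELATION ENTRYWISE** on the diagonal datum: `X ∈ Skew_T ⇒ T_ii · X_ij + c(X_ji) · T_jj = 0`. [cite: Shimura1997, §18.1] [cite: MoeglinWaldspurger1995, I.2.6] -/
theorem skew_entry {X : Matrix (Fin n) (Fin n) L}
    (hX : X ∈ skewMatrices ((IsCMField.complexConj L : L ≃ₐ[Fp L] L) : L →+* L) ((gramR L e dV hdV dW hdW).map (algebraMap (Fp L) L))) (i j : Fin n) :
    ((gramR L e dV hdV dW hdW).map (algebraMap (Fp L) L)) i i * X i j +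
      IsCMField.complexConj L (X j i) * ((gramR L e dV hdV dW hdW).map (algebraMap (Fp L) L)) j j = 0 := by
  rw [mem_skewMatrices_iff] at hX
  have h := congrFun (congrFun hX i) j
  rw [Matrix.add_apply, gramR_eq_diagonal, Matrix.diagonal_map (map_zero _), Matrix.diagonal_mul, Matrix.mul_diagonal, Matrix.transpose_apply,
    Matrix.map_apply, Matrix.zero_apply] at h
  rw [gramR_eq_diagonal, Matrix.diagonal_map (map_zero _), Matrix.diagonal_apply_eq, Matrix.diagonal_apply_eq]
  exact h

include hdV0 hdW0 in
/-- **the diagonal entries of a skew index are purely imaginary**: `X_ii + c X_ii = 0` (`T_ii ≠ 0` real). [cite: Shimura1997, §18.1] -/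
theorem skew_diag_add_conj {X : Matrix (Fin n) (Fin n) L}
    (hX : X ∈ skewMatrices ((IsCMField.complexConj L : L ≃ₐ[Fp L] L) : L →+* L) ((gramR L e dV hdV dW hdW).map (algebraMap (Fp L) L))) (i : Fin n) :
    X i i + IsCMField.complexConj L (X i i) = 0 := by
  have h := skew_entry L e dV hdV dW hdW hX i i
  rw [mul_comm (IsCMField.complexConj L (X i i)), ← mul_add] at h
  exact (mul_eq_zero.1 h).resolve_left (gramRL_apply_same_ne_zero L e dV hdV hdV0 dW hdW hdW0 i)

/-- the index set `Fin n` is `Fin 2` along `e` (`Fin 2 × Fin 1 ≃ Fin 2`): the equivalence `i ↦ e (i, 0)`. [folklore] -/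
theorem equivTwo_apply (i : Fin 2) : ((Equiv.prodUnique (Fin 2) (Fin 1)).symm.trans e) i = e (i, 0) := rfl

omit [NumberField L] [IsCMField L] in
/-- **`det X = X_aa X_bb − X_ab X_ba`** for `a = e(0,0)`, `b = e(1,0)` (`det` is invariant under the re-indexing `Fin 2 ≃ Fin n`, then `Matrix.det_fin_two`). [folklore] -/
theorem det_eq_two_by_two (X : Matrix (Fin n) (Fin n) L) :
    X.det = X (e (0, 0)) (e (0, 0)) * X (e (1, 0)) (e (1, 0)) - X (e (0, 0)) (e (1, 0)) * X (e (1, 0)) (e (0, 0)) := by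
  rw [← Matrix.det_submatrix_equiv_self ((Equiv.prodUnique (Fin 2) (Fin 1)).symm.trans e) X, Matrix.det_fin_two]
  rfl

omit [NumberField L] [IsCMField L] in
/-- a matrix on `Fin n ≃ Fin 2` with all four entries `X_aa, X_ab, X_ba, X_bb` zero is zero. [folklore] -/
theorem eq_zero_of_entries {X : Matrix (Fin n) (Fin n) L} (haa : X (e (0, 0)) (e (0, 0)) = 0) (hab : X (e (0, 0)) (e (1, 0)) = 0)
    (hba : X (e (1, 0)) (e (0, 0)) = 0) (hbb : X (e (1, 0)) (e (1, 0)) = 0) : X = 0 := by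
  ext i j
  obtain ⟨i', rfl⟩ := ((Equiv.prodUnique (Fin 2) (Fin 1)).symm.trans e).surjective i
  obtain ⟨j', rfl⟩ := ((Equiv.prodUnique (Fin 2) (Fin 1)).symm.trans e).surjective j
  rw [equivTwo_apply, equivTwo_apply, Matrix.zero_apply]
  fin_cases i' <;> fin_cases j' <;> assumption

include hdV0 hdW0 in
/-- **A NON-ZERO RANK-ONE SKEW INDEX HAS A NON-ZERO DIAGONAL ENTRY**: `X ∈ Skew_T`, `X ≠ 0`, `det X = 0 ⇒ X_aa ≠ 0 ∨ X_bb ≠ 0` — if both vanish, `det X = −X_ab X_ba =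
(T_aa ∕ T_bb) · X_ab · c(X_ab) = 0` forces `X_ab = 0 = X_ba`, i.e. `X = 0`. [cite: Shimura1997, §18.4] [cite: KudlaRallis1994, §2] -/
theorem diag_ne_zero_or {X : Matrix (Fin n) (Fin n) L}
    (hX : X ∈ skewMatrices ((IsCMField.complexConj L : L ≃ₐ[Fp L] L) : L →+* L) ((gramR L e dV hdV dW hdW).map (algebraMap (Fp L) L))) (hX0 : X ≠ 0)
    (hdet : X.det = 0) : X (e (0, 0)) (e (0, 0)) ≠ 0 ∨ X (e (1, 0)) (e (1, 0)) ≠ 0 := by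
  by_contra h
  push Not at h
  obtain ⟨haa, hbb⟩ := h
  -- `det X = −X_ab X_ba = 0`
  have hd : X (e (0, 0)) (e (1, 0)) * X (e (1, 0)) (e (0, 0)) = 0 := by
    have := det_eq_two_by_two L e X
    rw [hdet, haa, zero_mul, zero_sub] at this
    exact neg_eq_zero.1 this.symm
  -- `T_bb X_ba = −T_aa c(X_ab)`
  have hba : ((gramR L e dV hdV dW hdW).map (algebraMap (Fp L) L)) (e (1, 0)) (e (1, 0)) * X (e (1, 0)) (e (0, 0)) =
      -(IsCMField.complexConj L (X (e (0, 0)) (e (1, 0))) * ((gramR L e dV hdV dW hdW).map (algebraMap (Fp L) L)) (e (0, 0)) (e (0, 0))) :=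
    eq_neg_of_add_eq_zero_left (skew_entry L e dV hdV dW hdW hX (e (1, 0)) (e (0, 0)))
  have hTb := gramRL_apply_same_ne_zero L e dV hdV hdV0 dW hdW hdW0 (e (1, 0))
  have hTa := gramRL_apply_same_ne_zero L e dV hdV hdV0 dW hdW hdW0 (e (0, 0))
  -- multiply `hd` by `T_bb`: `X_ab · (−c(X_ab) T_aa) = 0`
  have hN : X (e (0, 0)) (e (1, 0)) * IsCMField.complexConj L (X (e (0, 0)) (e (1, 0))) = 0 := by
    have h1 : X (e (0, 0)) (e (1, 0)) * (((gramR L e dV hdV dW hdW).map (algebraMap (Fp L) L)) (e (1, 0)) (e (1, 0)) * X (e (1, 0)) (e (0, 0))) = 0 := by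
      rw [mul_left_comm, hd, mul_zero]
    rw [hba, mul_neg, neg_eq_zero, ← mul_assoc, mul_eq_zero] at h1
    exact h1.resolve_right hTa
  have hab : X (e (0, 0)) (e (1, 0)) = 0 := by
    rcases mul_eq_zero.1 hN with h | h
    · exact h
    · simpa using congrArg (IsCMField.complexConj L) h
  have hba0 : X (e (1, 0)) (e (0, 0)) = 0 := by
    rw [hab, map_zero, zero_mul, neg_zero, mul_eq_zero] at hba
    exact hba.resolve_left hTb
  exact hX0 (eq_zero_of_entries L e haa hab hba0 hbb)

/-! ## §2 The `hval` letter at `n ≃ 2` for the corner-first value `val₂` -/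

include hdV0 hdW0 in
/-- **`hval` AT `n ≃ 2`, HYPOTHESIS-FIRST ON THE TWO BRANCHES.**  Any `val : M_n(L) → L⁺` which on `T`-skew `X` equals `ip(X_bb)` when `ip(X_bb) ≠ 0` and
`(T_aa · T_bb⁻¹) · ip(X_aa)` when `ip(X_bb) = 0` (`ip x = (x − c x)(2α)⁻¹`, `α ≠ 0`) satisfies ★ p862379's binder: `X ∈ Skew_T → X ≠ 0 → det X = 0 → val X ≠ 0`.
(The tie instantiates `val` with the explicit `if`-term and discharges the two branch hypotheses by `if_neg` ∕ `if_pos`.)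
[cite: Shimura1997, §18.1, §18.4] [cite: Kudla1997, §2] [cite: KudlaRallis1994, §2] -/
theorem hval₂_of_branches {α : L} (hα0 : α ≠ 0) (hαc : IsCMField.complexConj L α = -α)
    (val : Matrix (Fin n) (Fin n) L → ↥(maximalRealSubfield L))
    (hb : ∀ X ∈ skewMatrices ((IsCMField.complexConj L : L ≃ₐ[Fp L] L) : L →+* L) ((gramR L e dV hdV dW hdW).map (algebraMap (Fp L) L)),
      (⟨(X (e (1, 0)) (e (1, 0)) - IsCMField.complexConj L (X (e (1, 0)) (e (1, 0)))) * (2 * α)⁻¹, imPart_mem L hαc _⟩ : ↥(maximalRealSubfield L)) ≠ 0 →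
        val X = ⟨(X (e (1, 0)) (e (1, 0)) - IsCMField.complexConj L (X (e (1, 0)) (e (1, 0)))) * (2 * α)⁻¹, imPart_mem L hαc _⟩)
    (ha : ∀ X ∈ skewMatrices ((IsCMField.complexConj L : L ≃ₐ[Fp L] L) : L →+* L) ((gramR L e dV hdV dW hdW).map (algebraMap (Fp L) L)),
      (⟨(X (e (1, 0)) (e (1, 0)) - IsCMField.complexConj L (X (e (1, 0)) (e (1, 0)))) * (2 * α)⁻¹, imPart_mem L hαc _⟩ : ↥(maximalRealSubfield L)) = 0 →
        val X = (gramR L e dV hdV dW hdW) (e (0, 0)) (e (0, 0)) * ((gramR L e dV hdV dW hdW) (e (1, 0)) (e (1, 0)))⁻¹ *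
          ⟨(X (e (0, 0)) (e (0, 0)) - IsCMField.complexConj L (X (e (0, 0)) (e (0, 0)))) * (2 * α)⁻¹, imPart_mem L hαc _⟩) :
    ∀ X ∈ skewMatrices ((IsCMField.complexConj L : L ≃ₐ[Fp L] L) : L →+* L) ((gramR L e dV hdV dW hdW).map (algebraMap (Fp L) L)),
      X ≠ 0 → X.det = 0 → val X ≠ 0 := by
  intro X hX hX0 hdet
  by_cases hbr : (⟨(X (e (1, 0)) (e (1, 0)) - IsCMField.complexConj L (X (e (1, 0)) (e (1, 0)))) * (2 * α)⁻¹, imPart_mem L hαc _⟩ :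
      ↥(maximalRealSubfield L)) = 0
  · -- corner entry vanishes: `X_bb = 0`, hence `X_aa ≠ 0`, and `val X = (T_aa ∕ T_bb) · ip(X_aa) ≠ 0`
    rw [ha X hX hbr]
    have hbb : X (e (1, 0)) (e (1, 0)) = 0 := by
      by_contra hbb
      exact imPart_ne_zero L hα0 hbb (skew_diag_add_conj L e dV hdV hdV0 dW hdW hdW0 hX (e (1, 0))) (congrArg Subtype.val hbr)
    have haa : X (e (0, 0)) (e (0, 0)) ≠ 0 := (diag_ne_zero_or L e dV hdV hdV0 dW hdW hdW0 hX hX0 hdet).resolve_right (not_not.2 hbb)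
    refine mul_ne_zero (mul_ne_zero (gramR_apply_same_ne_zero L e dV hdV hdV0 dW hdW hdW0 _)
      (inv_ne_zero (gramR_apply_same_ne_zero L e dV hdV hdV0 dW hdW hdW0 _))) ?_
    intro h
    exact imPart_ne_zero L hα0 haa (skew_diag_add_conj L e dV hdV hdV0 dW hdW hdW0 hX (e (0, 0))) (congrArg Subtype.val h)
  · rw [hb X hX hbr]
    exact hbr

include hdV0 hdW0 in
open scoped Classical in
/-- **THE `hval` LETTER AT `n ≃ 2` FOR THE EXPLICIT CORNER-FIRST VALUE** `val₂ X := if ip(X_bb) = 0 then (T_aa · T_bb⁻¹) · ip(X_aa) else ip(X_bb)` — ★ p862379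
`hdead_of_deadFactors`' binder `hval` BYTES at `val := val₂` (classical decidability of the `if`, as the tie pastes it).
[cite: Shimura1997, §18.1, §18.4] [cite: Kudla1997, §2] [cite: KudlaRallis1994, §2] -/
theorem hval₂ {α : L} (hα0 : α ≠ 0) (hαc : IsCMField.complexConj L α = -α) :
    ∀ X ∈ skewMatrices ((IsCMField.complexConj L : L ≃ₐ[Fp L] L) : L →+* L) ((gramR L e dV hdV dW hdW).map (algebraMap (Fp L) L)),
      X ≠ 0 → X.det = 0 →
        (if (⟨(X (e (1, 0)) (e (1, 0)) - IsCMField.complexConj L (X (e (1, 0)) (e (1, 0)))) * (2 * α)⁻¹, imPart_mem L hαc _⟩ : ↥(maximalRealSubfield L)) = 0 then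
            (gramR L e dV hdV dW hdW) (e (0, 0)) (e (0, 0)) * ((gramR L e dV hdV dW hdW) (e (1, 0)) (e (1, 0)))⁻¹ *
              (⟨(X (e (0, 0)) (e (0, 0)) - IsCMField.complexConj L (X (e (0, 0)) (e (0, 0)))) * (2 * α)⁻¹, imPart_mem L hαc _⟩ : ↥(maximalRealSubfield L))
          else ⟨(X (e (1, 0)) (e (1, 0)) - IsCMField.complexConj L (X (e (1, 0)) (e (1, 0)))) * (2 * α)⁻¹, imPart_mem L hαc _⟩) ≠ 0 :=
  hval₂_of_branches L e dV hdV hdV0 dW hdW hdW0 hα0 hαc _ (fun _ _ h => if_neg h) (fun _ _ h => if_pos h)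

include hdV0 hdW0 in
open scoped Classical in
/-- **`val₂ X · α² · T_bb = α · T_kk · X_kk` FOR A DIAGONAL ENTRY `X_kk ≠ 0`** (`k = b` on the corner branch, `k = a` on the other): in both branches `val₂ X · θ · T_bb`
is a non-zero diagonal entry `β_kk` of the `c`-hermitian rank-one matrix `β = α·T·X`, hence (★ `K2LiuRankOneLineGram`) a Gram value of the index — its NORM CLASS.
[cite: KudlaRallis1994, §3] [cite: Scharlau1985HermitianForms, Ch. 10 §1] [cite: Shimura1997, §18.4] -/
theorem val₂_mul_sq_mul {α : L} (hα0 : α ≠ 0) (hαc : IsCMField.complexConj L α = -α) {X : Matrix (Fin n) (Fin n) L}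
    (hX : X ∈ skewMatrices ((IsCMField.complexConj L : L ≃ₐ[Fp L] L) : L →+* L) ((gramR L e dV hdV dW hdW).map (algebraMap (Fp L) L))) (hX0 : X ≠ 0)
    (hdet : X.det = 0) :
    ∃ k : Fin n, X k k ≠ 0 ∧
      ((if (⟨(X (e (1, 0)) (e (1, 0)) - IsCMField.complexConj L (X (e (1, 0)) (e (1, 0)))) * (2 * α)⁻¹, imPart_mem L hαc _⟩ : ↥(maximalRealSubfield L)) = 0 then
            (gramR L e dV hdV dW hdW) (e (0, 0)) (e (0, 0)) * ((gramR L e dV hdV dW hdW) (e (1, 0)) (e (1, 0)))⁻¹ *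
              (⟨(X (e (0, 0)) (e (0, 0)) - IsCMField.complexConj L (X (e (0, 0)) (e (0, 0)))) * (2 * α)⁻¹, imPart_mem L hαc _⟩ : ↥(maximalRealSubfield L))
          else ⟨(X (e (1, 0)) (e (1, 0)) - IsCMField.complexConj L (X (e (1, 0)) (e (1, 0)))) * (2 * α)⁻¹, imPart_mem L hαc _⟩ : ↥(maximalRealSubfield L)) : L) *
          α ^ 2 * ((gramR L e dV hdV dW hdW).map (algebraMap (Fp L) L)) (e (1, 0)) (e (1, 0)) =
        α * ((gramR L e dV hdV dW hdW).map (algebraMap (Fp L) L)) k k * X k k := by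
  by_cases hbr : (⟨(X (e (1, 0)) (e (1, 0)) - IsCMField.complexConj L (X (e (1, 0)) (e (1, 0)))) * (2 * α)⁻¹, imPart_mem L hαc _⟩ :
      ↥(maximalRealSubfield L)) = 0
  · -- branch `a`
    have hbb : X (e (1, 0)) (e (1, 0)) = 0 := by
      by_contra hbb
      exact imPart_ne_zero L hα0 hbb (skew_diag_add_conj L e dV hdV hdV0 dW hdW hdW0 hX (e (1, 0))) (congrArg Subtype.val hbr)
    have haa : X (e (0, 0)) (e (0, 0)) ≠ 0 := (diag_ne_zero_or L e dV hdV hdV0 dW hdW hdW0 hX hX0 hdet).resolve_right (not_not.2 hbb)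
    refine ⟨e (0, 0), haa, ?_⟩
    have hmk : ((⟨(X (e (0, 0)) (e (0, 0)) - IsCMField.complexConj L (X (e (0, 0)) (e (0, 0)))) * (2 * α)⁻¹, imPart_mem L hαc _⟩ :
        ↥(maximalRealSubfield L)) : L) = (X (e (0, 0)) (e (0, 0)) - IsCMField.complexConj L (X (e (0, 0)) (e (0, 0)))) * (2 * α)⁻¹ := rfl
    rw [if_pos hbr, Subfield.coe_mul, Subfield.coe_mul, Subfield.coe_inv, coe_gramR_apply_same, coe_gramR_apply_same, hmk]
    have hTb := gramRL_apply_same_ne_zero L e dV hdV hdV0 dW hdW hdW0 (e (1, 0))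
    have hip := imPart_mul_root_eq_self L hα0 (skew_diag_add_conj L e dV hdV hdV0 dW hdW hdW0 hX (e (0, 0)))
    calc _ = ((gramR L e dV hdV dW hdW).map (algebraMap (Fp L) L)) (e (0, 0)) (e (0, 0)) *
          ((X (e (0, 0)) (e (0, 0)) - IsCMField.complexConj L (X (e (0, 0)) (e (0, 0)))) * (2 * α)⁻¹ * α) * α *
          ((((gramR L e dV hdV dW hdW).map (algebraMap (Fp L) L)) (e (1, 0)) (e (1, 0)))⁻¹ *
            ((gramR L e dV hdV dW hdW).map (algebraMap (Fp L) L)) (e (1, 0)) (e (1, 0))) := by ring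
      _ = _ := by rw [hip, inv_mul_cancel₀ hTb, mul_one]; ring
  · -- branch `b`
    have hbb : X (e (1, 0)) (e (1, 0)) ≠ 0 := by
      intro hbb
      apply hbr
      apply Subtype.ext
      change (X (e (1, 0)) (e (1, 0)) - IsCMField.complexConj L (X (e (1, 0)) (e (1, 0)))) * (2 * α)⁻¹ = 0
      rw [hbb, map_zero, sub_zero, zero_mul]
    refine ⟨e (1, 0), hbb, ?_⟩
    have hmk : ((⟨(X (e (1, 0)) (e (1, 0)) - IsCMField.complexConj L (X (e (1, 0)) (e (1, 0)))) * (2 * α)⁻¹, imPart_mem L hαc _⟩ :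
        ↥(maximalRealSubfield L)) : L) = (X (e (1, 0)) (e (1, 0)) - IsCMField.complexConj L (X (e (1, 0)) (e (1, 0)))) * (2 * α)⁻¹ := rfl
    rw [if_neg hbr, hmk]
    have hip := imPart_mul_root_eq_self L hα0 (skew_diag_add_conj L e dV hdV hdV0 dW hdW hdW0 hX (e (1, 0)))
    calc _ = ((X (e (1, 0)) (e (1, 0)) - IsCMField.complexConj L (X (e (1, 0)) (e (1, 0)))) * (2 * α)⁻¹ * α) * α *
          ((gramR L e dV hdV dW hdW).map (algebraMap (Fp L) L)) (e (1, 0)) (e (1, 0)) := by ring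
      _ = _ := by rw [hip]; ring

end Summit.HodgeConjecture.HodgeConjecture.Cruxes.HLiu418.K2LiuRankOneIndexValueTwo

end
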